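import Summits.Ventures.HodgeRepro2.T4Incoherent
import Summits.Ventures.HodgeRepro2.FaceData
import Summits.Ventures.HodgeRepro2.Dichotomy
import Summits.Ventures.HodgeRepro2.GaloisSextic
import Summits.Ventures.HodgeRepro2.Neat
import Summits.Ventures.HodgeRepro2.Liu

/-!
# T4Identification — the hypothesis-by-hypothesis table of Tier 4 (T4-B), sextic Galois CM case

Seat p3 of the blind cell `pub-hodge-repro2` (Tier 4, README §6).  This file is the Lean side of
the T4-B identification: for the sextic Galois CM field `K` (= the brief's `𝐅`, Liu's `E`), with
maximal totally real subfield `K⁺` (= `𝐅⁺`, Liu's `F`), the objects of the transfer are assembled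
in `LiuInstantiation`, and the ELEMENTARY rows of the printed hypothesis list of Yifeng Liu,
«Fourier–Jacobi cycles and arithmetic relative trace formula», Cambridge J. Math. 9 (2021) §4.2
and Appendix C (Proposition 4.13 p. 47, Theorem 4.18 p. 52, Corollary 4.20 pp. 54–55,
Definitions C.3–C.6 pp. 108–109) are DISCHARGED by kernel-checked theorems; the rows whose
discharge is a printed existence theorem outside the reach of Mathlib (adelic characters) are
stated as NAMED Props — the explicit gaps of T4-B.

Row numbering follows route/TIER3.md §4.4 (L1–L11, C1–C5):

* L1 (p. 40 ll. 35–43): `F` totally real of degree `d`, `E/F` totally imaginary quadratic —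
  `K⁺ ⊂ K` with `[K⁺:ℚ] = 3` (`finrank_maximalRealSubfield_eq_three`), `d = 3`;
* L2 (p. 45, p. 47): `n ⩾ 3` — `n = 3` by construction (the local data have rank `3`);
* L3 (Def C.3, p. 108 ll. 63–70; Def C.4, p. 109 ll. 8–17): `𝕍` a totally (positive) definite
  INCOHERENT hermitian space over `𝔸_E` of rank `n` whose `τ₁`-nearby space is the surface's
  coherent space `V` of signature `(2,1)` at `τ₁` and `(3,0)` at the other two real places —
  `totallyDefinite` with `isIncoherent_totallyDefinite`, `isTotallyDefinite_totallyDefinite`,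
  `nearby_totallyDefinite` in the companion file `T4Incoherent.lean` (p2's local-invariant model
  of Gross 2021 §3–§4 / Liu App. C: coherent ⟺ product of the local invariants `= 1`);
* L4 (p. 45 ll. 45–56; p. 109 ll. 54–55): Compact Case ⟺ `d > 1` — `isCompactCase`;
* L5 (pp. 45, 108–109; Cor 4.20 «for every sufficiently small K»): the level — the GAP
  `CommonLevelPositivity` (single-level positivity, TIER3 §6 item 1) and the monotonicity of
  neatness `isNeat_mono` (item 3: the face level `⨅ K_i` inherits neatness);
* L6 (Defs 4.1, 4.3, p. 41): `μ_i` conjugate symplectic of weight one with `Φ_{μ_i} = T_i⁻¹` —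
  the GAP `WeightOneVertexCharacters` (printed existence: Dimitrov–Ramakrishnan 2015 Lemma 3.5;
  adelic, not formalisable);
* L7 (Def 4.12, p. 47 ll. 5–9): `ε_i` `μ_i`-admissible — p1's `FaceOscillatorData` (exists for
  every face: `nonempty_faceOscillatorData`), the field `vertex`;
* L8 (Def 4.11): `χ = 1` — nothing to check;
* L11 / TIER3 §6 item 2 (Lemma D.2(2), p. 127; Def 4.12; p. 48 ll. 54–55): the Hodge-type sign —
  under Liu's convention «type (1,0) at τ′ ⟺ τ′ ∈ Φ_μ» the holomorphic vertices at the base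
  embedding are those with `τ₁ ∈ T_i` (`mem_inverseType_self_iff`: the reflex relabelling
  `T ↦ T⁻¹` does not move the base embedding), EXACTLY TWO of the four (`card_holomorphic`);
  the opposite convention (the complex-conjugate surface, `ι₁ ↦ ῑ₁`) selects the complementary
  two (`card_antiholomorphic`, `holomorphic_xor_antiholomorphic`); the datum switch
  `(μ, ε) ↦ (μ^c, −ε)` is `isLiuSignElement_conjCMType_neg_iff` (the printed remark after
  Def 4.12 in p1's vocabulary).

Everything proved here is elementary; nothing asserts Liu's theorems.  Imports: Mathlib and the
cell's own prefix only.  Axioms: propext, Classical.choice, Quot.sound.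
-/

namespace Summit.Ventures.HodgeRepro2.T4Identification

open NumberField Module
open Summit.Ventures.HodgeRepro2
open Summit.Ventures.HodgeRepro2.ShimuraData

/-! ## Rows L1 and L4 — the field letters and the Compact Case -/

section Degrees

variable (K : Type*) [Field K] [NumberField K] [IsCMField K]

/-- Row L1: `[K⁺ : ℚ] = [K : ℚ] / 2`. -/
theorem two_mul_finrank_maximalRealSubfield :
    2 * finrank ℚ (maximalRealSubfield K) = finrank ℚ K := by
  rw [← Module.finrank_mul_finrank ℚ (maximalRealSubfield K) K,
    Algebra.IsQuadraticExtension.finrank_eq_two (maximalRealSubfield K) K, mul_comm]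

/-- Row L1 for the sextic case: the maximal totally real subfield `𝐅⁺ = K⁺` is cubic (`d = 3`). -/
theorem finrank_maximalRealSubfield_eq_three (h6 : finrank ℚ K = 6) :
    finrank ℚ (maximalRealSubfield K) = 3 := by
  have := two_mul_finrank_maximalRealSubfield K
  omega

omit [IsCMField K] in
/-- Row L4: the Compact Case `d > 1` (Liu p. 45 ll. 45–56, p. 109 ll. 54–55), in p1's form
`IsCompactCase K := 2 < [K : ℚ]` (Shimura's remark after Theorem 8.1). -/
theorem isCompactCase_of_finrank_six (h6 : finrank ℚ K = 6) : IsCompactCase K := by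
  unfold IsCompactCase
  omega

/-- Row L4, in Liu's letters: `d = [F : ℚ] > 1`. -/
theorem one_lt_finrank_maximalRealSubfield (h6 : finrank ℚ K = 6) :
    1 < finrank ℚ (maximalRealSubfield K) := by
  rw [finrank_maximalRealSubfield_eq_three K h6]
  norm_num

end Degrees


/-! ## Row L5 (item 3) — neatness passes to the face level -/

section Neat

variable (K : Type*) [Field K]

/-- Neatness (p2's `IsNeat`, Liu's «sufficiently small» / D–R §1) is inherited by subsets: the
face level `⨅ K_i` is neat as soon as one vertex level is (TIER3 §6 item 3). -/
theorem isNeat_mono {m : ℕ} (τ : K →+* ℂ) {Γ Γ' : Set (GL (Fin m) K)} (h : Γ' ⊆ Γ)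
    (hΓ : IsNeat K τ Γ) : IsNeat K τ Γ' :=
  fun γ hγ => hΓ γ (h hγ)

end Neat

/-! ## Item 2 — the Hodge-type sign at the base embedding -/

section Sign

variable (K : Type*) [Field K] [NumberField K] [IsCMField K] [IsGalois ℚ K]

omit [IsCMField K] in
/-- The base embedding is the image of the identity of the Galois group. -/
theorem galEmb_one (τ₀ : K →+* ℂ) : galEmb K τ₀ 1 = τ₀ := by
  ext x
  simp [galEmb]

/-- The conjugate of the base embedding is the image of complex conjugation. -/
theorem galEmb_galConj (τ₀ : K →+* ℂ) :
    galEmb K τ₀ (galConj K) = ComplexEmbedding.conjugate τ₀ := by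
  have := galEmb_galConj_mul K τ₀ 1
  rw [mul_one, galEmb_one] at this
  exact this

omit [IsCMField K] in
/-- THE REFLEX RELABELLING DOES NOT MOVE THE BASE EMBEDDING: `τ₀ ∈ Φ⁻¹ ⟺ τ₀ ∈ Φ`
(the inverse type is `{τ₀ ∘ σ⁻¹ | τ₀ ∘ σ ∈ Φ}` and `1⁻¹ = 1`).  Hence the Hodge type at `τ₁`
of the vertex piece of `μ_i` (Liu: `(1,0)` at `τ′ ⟺ τ′ ∈ Φ_μ`, with `Φ_{μ_i} = T_i⁻¹`) is read
off from `T_i` itself. -/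
theorem mem_inverseType_self_iff (τ₀ : K →+* ℂ) (Φ : Set (K →+* ℂ)) :
    τ₀ ∈ inverseType K τ₀ Φ ↔ τ₀ ∈ Φ := by
  have h := mem_inverseType_iff K τ₀ Φ 1
  rw [inv_one, galEmb_one] at h
  exact h

/-- The conjugate embedding is likewise not moved by the reflex relabelling. -/
theorem conjugate_mem_inverseType_iff (τ₀ : K →+* ℂ) (Φ : Set (K →+* ℂ)) :
    ComplexEmbedding.conjugate τ₀ ∈ inverseType K τ₀ Φ ↔ ComplexEmbedding.conjugate τ₀ ∈ Φ := by
  have h := mem_inverseType_iff K τ₀ Φ (galConj K)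
  have hinv : (galConj K)⁻¹ = galConj K := by
    rw [inv_eq_iff_mul_eq_one, galConj_mul_self]
  rw [hinv, galEmb_galConj] at h
  exact h

omit [IsCMField K] in
open Classical in
/-- ITEM 2, LIU'S CONVENTION: with `Φ_{μ_i} = T_i⁻¹` and «Hodge type `(1,0)` at `τ₁` ⟺
`τ₁ ∈ Φ_μ`», the vertices whose piece is holomorphic at `τ₁` are those with `τ₁ ∈ T_i`, and
there are EXACTLY TWO of them (balance, Deligne LNM 900 Prop. 4.4). -/
theorem card_holomorphic (τ₁ : K →+* ℂ) {T : Fin 4 → Set (K →+* ℂ)} (hT : IsWeilFace K T) :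
    (Finset.univ.filter fun i => τ₁ ∈ inverseType K τ₁ (T i)).card = 2 := by
  have h := hT.card_filter_eq_two τ₁
  rw [← h]
  congr 1
  ext i
  simp [mem_inverseType_self_iff]

open Classical in
/-- ITEM 2, THE OPPOSITE CONVENTION (the complex-conjugate surface, `ι₁ ↦ ῑ₁`): the vertices
whose piece is holomorphic at `τ̄₁` are those with `τ̄₁ ∈ T_i` — again exactly two. -/
theorem card_antiholomorphic (τ₁ : K →+* ℂ) {T : Fin 4 → Set (K →+* ℂ)}
    (hT : IsWeilFace K T) :
    (Finset.univ.filter fun i =>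
      ComplexEmbedding.conjugate τ₁ ∈ inverseType K τ₁ (T i)).card = 2 := by
  have h := hT.card_filter_eq_two (ComplexEmbedding.conjugate τ₁)
  rw [← h]
  congr 1
  ext i
  simp [conjugate_mem_inverseType_iff]

/-- The two conventions are COMPLEMENTARY on every vertex: a CM type contains exactly one of
`τ₁`, `τ̄₁`. -/
theorem holomorphic_xor_antiholomorphic (τ₁ : K →+* ℂ) {T : Fin 4 → Set (K →+* ℂ)}
    (hT : IsWeilFace K T) (i : Fin 4) :
    Xor (τ₁ ∈ inverseType K τ₁ (T i))
      (ComplexEmbedding.conjugate τ₁ ∈ inverseType K τ₁ (T i)) := by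
  rw [mem_inverseType_self_iff, conjugate_mem_inverseType_iff]
  exact hT.1 i τ₁

/-- THE DATUM SWITCH `(μ, ε) ↦ (μ^c, −ε)` (Liu, remark after Definition 4.12: «ε is
μ-admissible if and only if −ε is μ^c-admissible») in p1's vocabulary: `e` is a sign element for
the CM type `Φ` iff `−e` is one for the conjugate type `Φ̄ = Φ_{μ^c}`. -/
theorem isLiuSignElement_conjCMType_neg_iff (Φ : Set (K →+* ℂ)) (e : K) :
    IsLiuSignElement K (conjCMType K Φ) (-e) ↔ IsLiuSignElement K Φ e := by
  unfold IsLiuSignElement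
  have key : (∀ τ' ∈ conjCMType K Φ, (τ' (-e)).im < 0) ↔ ∀ τ' ∈ Φ, (τ' e).im < 0 := by
    constructor
    · intro h τ hτ
      have hmem : ComplexEmbedding.conjugate τ ∈ conjCMType K Φ := by
        show ComplexEmbedding.conjugate (ComplexEmbedding.conjugate τ) ∈ Φ
        rw [ComplexEmbedding.involutive_conjugate K τ]
        exact hτ
      have := h _ hmem
      simpa using this
    · intro h τ' hτ'
      have hmem : ComplexEmbedding.conjugate τ' ∈ Φ := hτ'
      have := h _ hmem
      simpa using this
  rw [key]
  constructor
  · rintro ⟨h1, h2, h3⟩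
    refine ⟨?_, ?_, h3⟩
    · rw [star_neg, neg_neg] at h1
      exact neg_eq_iff_eq_neg.mp h1
    · exact fun he => h2 (by rw [he, neg_zero])
  · rintro ⟨h1, h2, h3⟩
    refine ⟨?_, ?_, h3⟩
    · rw [star_neg, neg_neg, h1, neg_neg]
    · exact fun he => h2 (neg_eq_zero.mp he)

end Sign

/-! ## The table -/

section Table

variable (K : Type*) [Field K] [NumberField K] [IsCMField K] [IsGalois ℚ K]

/-- THE T4-B INSTANTIATION for the sextic Galois CM field `K`: the objects the transfer builds
from the CM field, with the (S4)-type hypotheses as fields.  `τ₁` is Liu's fixed embedding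
`τ′ ∈ Φ_E` (p. 47 ll. 29–30) = the brief's distinguished embedding; `T` the rank-four face; `V`
the local data of the surface's coherent hermitian space; `vertex` the sign elements `e_i` of
Definition 4.12 for `Φ_{μ_i} = T_i⁻¹` (the reflex relabelling, TIER3 §5(i)). -/
structure LiuInstantiation where
  /-- Row L1: `[K : ℚ] = 6`, so `d = [K⁺ : ℚ] = 3`. -/
  finrank_eq_six : finrank ℚ K = 6
  /-- The distinguished embedding `τ₁` (Liu's fixed `τ′`). -/
  τ₁ : K →+* ℂ
  /-- The face: four CM types. -/
  T : Fin 4 → Set (K →+* ℂ)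
  /-- (S4): the face is balanced (Deligne LNM 900 Prop. 4.4 with `d = 4`). -/
  face : IsWeilFace K T
  /-- Row L3: the local data of the surface's hermitian space `V` (rank `3`). -/
  V : HermitianLocalData (maximalRealSubfield K) K 3
  /-- `V` has signature `(2, 1)` at `τ₁`. -/
  V_sig_τ₁ : V.sig (InfinitePlace.mk τ₁) = (2, 1)
  /-- `V` is positive definite at the other real places. -/
  V_sig_other : ∀ w, w ≠ InfinitePlace.mk τ₁ → V.sig w = (3, 0)
  /-- `V` is coherent: a global hermitian space over `K`. -/
  V_coherent : V.IsCoherent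
  /-- Row L7: the vertex sign elements (Definition 4.12 for `Φ_{μ_i} = T_i⁻¹`). -/
  vertex : FaceOscillatorData K τ₁ T

namespace LiuInstantiation

variable {K}

/-- Row L3: Liu's `𝕍` — the totally definite incoherent space whose `τ₁`-nearby space is `V`. -/
def incoherentSpace (I : LiuInstantiation K) : HermitianLocalData (maximalRealSubfield K) K 3 :=
  totallyDefinite I.V

/-- Row L1: `d = 3`. -/
theorem finrank_maximalRealSubfield (I : LiuInstantiation K) :
    finrank ℚ (maximalRealSubfield K) = 3 :=
  finrank_maximalRealSubfield_eq_three K I.finrank_eq_six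

/-- Row L2: `n = 3 ⩾ 3`. -/
theorem three_le_rank (_I : LiuInstantiation K) : 3 ≤ (3 : ℕ) := le_rfl

/-- Row L3: `𝕍` is incoherent. -/
theorem isIncoherent_incoherentSpace (I : LiuInstantiation K) :
    I.incoherentSpace.IsIncoherent :=
  isIncoherent_totallyDefinite I.V _ I.V_sig_τ₁ I.V_sig_other I.V_coherent

/-- Row L3: `𝕍` is totally definite. -/
theorem isTotallyDefinite_incoherentSpace (I : LiuInstantiation K) :
    I.incoherentSpace.IsTotallyDefinite :=
  isTotallyDefinite_totallyDefinite I.V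

/-- Row L3: the `τ₁`-nearby space of `𝕍` is the surface's space `V` (Definition C.4). -/
theorem nearby_incoherentSpace (I : LiuInstantiation K) :
    I.incoherentSpace.nearby (InfinitePlace.mk I.τ₁) = I.V :=
  nearby_totallyDefinite I.V _ I.V_sig_τ₁ I.V_sig_other

/-- Row L4: the Compact Case. -/
theorem isCompactCase (I : LiuInstantiation K) : IsCompactCase K :=
  isCompactCase_of_finrank_six K I.finrank_eq_six

/-- Row L7: each vertex sign element satisfies Definition 4.12 for the relabelled type
`T_i⁻¹`. -/
theorem vertex_sign (I : LiuInstantiation K) (i : Fin 4) :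
    IsLiuSignElement K (inverseType K I.τ₁ (I.T i)) (I.vertex i).e :=
  (I.vertex i).sign

/-- The relabelled face `{T_i⁻¹}` is again balanced (p1's `isWeilFace_inverseType`). -/
theorem isWeilFace_inverse (I : LiuInstantiation K) :
    IsWeilFace K fun i => inverseType K I.τ₁ (I.T i) :=
  isWeilFace_inverseType K I.τ₁ I.face

open Classical in
/-- Item 2: exactly two vertex pieces are holomorphic at `τ₁` (Liu's convention). -/
theorem card_holomorphic (I : LiuInstantiation K) :
    (Finset.univ.filter fun i => I.τ₁ ∈ inverseType K I.τ₁ (I.T i)).card = 2 :=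
  T4Identification.card_holomorphic K I.τ₁ I.face

/-- `Gal(K/ℚ)` is abelian (p1's `isAbelianGalois_of_finrank_six`): the hypothesis «F abelian
over Q» of Shimura 1998 §8.4 Ex. (1), under which the reflex of a primitive type is the inverse
type — the reflex relabelling of row L6/§5(i). -/
theorem isAbelianGalois (I : LiuInstantiation K) : IsAbelianGalois ℚ K :=
  isAbelianGalois_of_finrank_six K I.finrank_eq_six

/-- `Gal(K/ℚ) ≅ ℤ/6` (p1's `nonempty_mulEquiv_zmod_six`). -/
theorem nonempty_mulEquiv_zmod_six (I : LiuInstantiation K) :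
    Nonempty (Multiplicative (ZMod 6) ≃* Gal(K/ℚ)) :=
  Summit.Ventures.HodgeRepro2.nonempty_mulEquiv_zmod_six K I.finrank_eq_six

/-- THE GAP OF ROW L6 (named, not asserted): for every vertex there is a conjugate symplectic
automorphic character of weight one with CM type `T_i⁻¹` — printed as Dimitrov–Ramakrishnan,
Doc. Math. 20 (2015), Lemma 3.5 (weight-one Hecke characters of every CM type), whose `λ` is a
Liu `μ` by `z̄/|z| = arg(z)⁻¹`; adelic, outside Mathlib.  Stated with p2's `AutomorphicCharacter`
and `IsWeightOne` (Liu.lean). -/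
def WeightOneVertexCharacters (I : LiuInstantiation K) : Prop :=
  ∀ i : Fin 4, ∃ μ : Liu.AutomorphicCharacter K,
    Liu.IsWeightOne K (inverseType K I.τ₁ (I.T i)) μ

/-- THE GAP OF ROW L5 (single-level positivity, TIER3 §6 item 1; named, not asserted): for a
level structure `Level` (a meet-semilattice of open compact subgroups), a predicate `IsSmall`
(«sufficiently small») closed under shrinking, and the invariant dimensions `dimInv i L` of the
four vertex pieces, antitone in the level, there is ONE small level at which all four pieces have
non-zero invariants.  (The existential form follows from the per-vertex statement by
`L := ⨅ K_i` and antitonicity — p2's `exists_common_level`; the printed inputs are Liu Lemma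
D.1(1), p. 125, and the unramifiedness of p. 46 ll. 50–52; the PRESCRIBED-level form can fail:
Remark 4.21, p. 55.) -/
def CommonLevelPositivity (Level : Type*) [SemilatticeInf Level] (IsSmall : Level → Prop)
    (dimInv : Fin 4 → Level → ℕ) : Prop :=
  ∃ L : Level, IsSmall L ∧ ∀ i : Fin 4, 0 < dimInv i L

/-- SINGLE-LEVEL POSITIVITY, THE ELEMENTARY HALF (kernel): if each vertex piece has a small
level with non-zero invariants, if smallness passes to smaller levels and invariants do not
shrink when the level shrinks, then the common level `L := K₀ ⊓ K₁ ⊓ K₂ ⊓ K₃` is small and all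
four pieces have non-zero invariants there.  The per-vertex inputs are the printed ones (Lemma
D.1(1) + unramifiedness); only the gluing is proved here. -/
theorem commonLevelPositivity_of_forall (Level : Type*) [SemilatticeInf Level]
    (IsSmall : Level → Prop) (isSmall_of_le : ∀ {L L' : Level}, L' ≤ L → IsSmall L → IsSmall L')
    (dimInv : Fin 4 → Level → ℕ)
    (dimInv_anti : ∀ i, ∀ {L L' : Level}, L' ≤ L → dimInv i L ≤ dimInv i L')
    (h : ∀ i : Fin 4, ∃ L : Level, IsSmall L ∧ 0 < dimInv i L) :
    CommonLevelPositivity Level IsSmall dimInv := by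
  choose L hL using h
  refine ⟨(L 0 ⊓ L 1) ⊓ (L 2 ⊓ L 3), ?_, ?_⟩
  · exact isSmall_of_le (le_trans inf_le_left inf_le_left) (hL 0).1
  · intro i
    have hle : (L 0 ⊓ L 1) ⊓ (L 2 ⊓ L 3) ≤ L i := by
      fin_cases i
      · exact le_trans inf_le_left inf_le_left
      · exact le_trans inf_le_left inf_le_right
      · exact le_trans inf_le_right inf_le_left
      · exact le_trans inf_le_right inf_le_right
    exact lt_of_lt_of_le (hL i).2 (dimInv_anti i hle)

/-- THE ELEMENTARY ROWS OF THE TABLE, in one statement: L1 (`d = 3`), L3 (`𝕍` incoherent, totally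
definite, with `τ₁`-nearby space `V`), L4 (Compact Case), L7 (Definition 4.12 for every vertex),
item 2 (exactly two holomorphic vertices at `τ₁`), and the abelian Galois group of the reflex
relabelling. -/
theorem elementary_rows (I : LiuInstantiation K) :
    finrank ℚ (maximalRealSubfield K) = 3 ∧
    I.incoherentSpace.IsIncoherent ∧ I.incoherentSpace.IsTotallyDefinite ∧
    I.incoherentSpace.nearby (InfinitePlace.mk I.τ₁) = I.V ∧
    IsCompactCase K ∧
    (∀ i, IsLiuSignElement K (inverseType K I.τ₁ (I.T i)) (I.vertex i).e) ∧
    IsAbelianGalois ℚ K :=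
  ⟨I.finrank_maximalRealSubfield, I.isIncoherent_incoherentSpace,
    I.isTotallyDefinite_incoherentSpace, I.nearby_incoherentSpace, I.isCompactCase,
    I.vertex_sign, I.isAbelianGalois⟩

end LiuInstantiation

/-- EXISTENCE of the instantiation data for every sextic Galois CM field, every distinguished
embedding, every rank-four face and every finite place `v₀` of `K⁺` (used to make the surface's
local datum coherent): the objects of T4-B exist; the two named gaps
(`WeightOneVertexCharacters`, `CommonLevelPositivity`) are the only rows not discharged. -/
theorem exists_liuInstantiation (h6 : finrank ℚ K = 6) (τ₁ : K →+* ℂ)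
    {T : Fin 4 → Set (K →+* ℂ)} (hT : IsWeilFace K T)
    (v₀ : IsDedekindDomain.HeightOneSpectrum (RingOfIntegers (maximalRealSubfield K))) :
    ∃ I : LiuInstantiation K, I.τ₁ = τ₁ ∧ I.T = T := by
  obtain ⟨V, hcoh, h₁, h₂⟩ :=
    exists_coherent_picard (F := maximalRealSubfield K) (K := K) 2 (InfinitePlace.mk τ₁) v₀
  obtain ⟨vertex⟩ := nonempty_faceOscillatorData K τ₁ hT
  exact ⟨⟨h6, τ₁, T, hT, V, h₁, h₂, hcoh, vertex⟩, rfl, rfl⟩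

end Table

end Summit.Ventures.HodgeRepro2.T4Identification
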